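import Summits.PneNP.PneNP.Theorems.PhaseTwinsPolyDepthTwinsAboveAcDefs
import Literature.Computability.Complexity.HardcoreInapproximabilityFirstMoment

/-!
# Route PhaseTwins, crux `PolyDepthTwinsAbove` (stmt-PneNP-2719), line `annealed-cover-twins`:
explicit Stirling bookkeeping (milestone M3 of `stub_annealedPortLaw`, part 1)

Two-sided logarithmic estimates with explicit constants, the raw material of the Stirling envelope
of the typed matching count: `log N! = N log N - N + (log N)/2 + [0, 1]` (`log_factorial_stirling`,
from Mathlib's Stirling sequence via the tree's `BinomialEntropy`), `|log C(N,k) - N·H| ≤ (log N)/2 + 1`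
(`abs_log_choose_sub_entropy_le`, the tree's `log_choose_le_entropy` / `entropy_sub_le_log_choose`),
the multinomial `log (n!/∏ n_s!) = -n Σ_s ν_s log ν_s ± (2 log n + 4)` (`abs_log_multinomial4_sub_le`),
the scaling `n · xlogx (a/n) = a log a - a log n` (`natMul_xlogx_div`), and the half-class form of
the line's `coverPsi` (`coverPsi_eq`: `xlogx (x/2) + (x/2) log 2 = xlogx x / 2`). [folklore]
-/

noncomputable section

open scoped Classical BigOperators

namespace Summit.PneNP.PneNP.Cruxes.PolyDepthTwinsAbove.AnnealedCoverTwins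

open Finset
open Literature.Probability.LatticeModels (factorial_eq_stirlingSeq_mul stirlingSeq_pos
  sqrt_pi_le_stirlingSeq' stirlingSeq_le_exp_one_div)
open Literature.Computability.Complexity (log_choose_le_entropy entropy_sub_le_log_choose)

set_option linter.dupNamespace false

/-! ## Factorials -/

/-- **Stirling with explicit constants**: `0 ≤ log N! - (N log N - N + (log N)/2) ≤ 1` for `N ≥ 1`
(the bracket is `log (s_N √2)` with `√π ≤ s_N ≤ e/√2`). -/
theorem log_factorial_stirling {N : ℕ} (hN : N ≠ 0) :
    0 ≤ Real.log (N.factorial : ℝ) - (N * Real.log N - N + Real.log N / 2) ∧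
      Real.log (N.factorial : ℝ) - (N * Real.log N - N + Real.log N / 2) ≤ 1 := by
  have hNpos : (0 : ℝ) < N := by exact_mod_cast Nat.pos_of_ne_zero hN
  have hspos := stirlingSeq_pos hN
  have hlog : Real.log (N.factorial : ℝ) =
      Real.log (Stirling.stirlingSeq N) + (Real.log 2 + Real.log N) / 2 + (N * Real.log N - N) := by
    rw [factorial_eq_stirlingSeq_mul hN, Real.log_mul (by positivity) (by positivity),
      Real.log_mul hspos.ne' (by positivity), Real.log_exp, Real.log_sqrt (by positivity),
      Real.log_mul (by norm_num) hNpos.ne']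
  have h1 : Real.log (Real.sqrt Real.pi) ≤ Real.log (Stirling.stirlingSeq N) :=
    Real.log_le_log (by positivity) (sqrt_pi_le_stirlingSeq' hN)
  have h2 : Real.log (Stirling.stirlingSeq N) ≤ Real.log (Real.exp 1 / Real.sqrt 2) :=
    Real.log_le_log hspos (stirlingSeq_le_exp_one_div hN)
  rw [Real.log_sqrt Real.pi_pos.le] at h1
  rw [Real.log_div (by positivity) (by positivity), Real.log_exp, Real.log_sqrt (by norm_num)] at h2
  have hπ : 0 ≤ Real.log Real.pi := Real.log_nonneg (by linarith [Real.pi_gt_three])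
  have h2' : 0 ≤ Real.log 2 := Real.log_nonneg (by norm_num)
  rw [hlog]
  constructor <;> linarith

/-- The same for all `N`, as an absolute value: `|log N! - (N log N - N + (log N)/2)| ≤ 1`. -/
theorem abs_log_factorial_sub_le_one (N : ℕ) :
    |Real.log (N.factorial : ℝ) - (N * Real.log N - N + Real.log N / 2)| ≤ 1 := by
  rcases Nat.eq_zero_or_pos N with rfl | hN
  · simp
  · obtain ⟨h1, h2⟩ := log_factorial_stirling hN.ne'
    rw [abs_le]; constructor <;> linarith

/-- `log (n!/(n-k)!) = log n! - log (n-k)!` for `k ≤ n`. -/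
theorem log_descFactorial {n k : ℕ} (hk : k ≤ n) :
    Real.log (n.descFactorial k : ℝ) = Real.log (n.factorial : ℝ) - Real.log ((n - k).factorial : ℝ) := by
  have h := Nat.factorial_mul_descFactorial hk
  have h' : ((n - k).factorial : ℝ) * (n.descFactorial k : ℝ) = (n.factorial : ℝ) := by exact_mod_cast h
  have hpos : (0 : ℝ) < (n - k).factorial := by exact_mod_cast Nat.factorial_pos _
  have hpos' : (0 : ℝ) < n.descFactorial k := by
    have : n.descFactorial k ≠ 0 := fun h0 => by
      rw [Nat.descFactorial_eq_zero_iff_lt] at h0; omega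
    exact_mod_cast Nat.pos_of_ne_zero this
  rw [← h', Real.log_mul hpos.ne' hpos'.ne']
  ring

/-! ## Binomial and multinomial coefficients -/

/-- `|log C(N,k) - (N log N - k log k - (N-k) log (N-k))| ≤ (log N)/2 + 1` for all `k ≤ N`. -/
theorem abs_log_choose_sub_entropy_le {N k : ℕ} (hk : k ≤ N) :
    |Real.log (N.choose k : ℝ) - (N * Real.log N - k * Real.log k - ((N : ℝ) - k) * Real.log ((N : ℝ) - k))| ≤
      Real.log N / 2 + 1 := by
  rcases Nat.eq_zero_or_pos N with rfl | hN
  · have hk0 : k = 0 := by omega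
    subst hk0
    simp
  have h1 := log_choose_le_entropy N k hk
  have h2 := entropy_sub_le_log_choose N k hN hk
  have hlogN : 0 ≤ Real.log N := Real.log_nonneg (by exact_mod_cast hN)
  rw [abs_le]; constructor <;> linarith

/-- **Multinomial coefficients of four classes**:
`|log (n!/(n₀! n₁! n₂! n₃!)) - (n log n - Σ_s n_s log n_s)| ≤ 2 log n + 5` (`n = Σ n_s`). -/
theorem abs_log_multinomial4_sub_le (a b c d : ℕ) :
    |Real.log ((a + b + c + d).factorial : ℝ) - Real.log (a.factorial : ℝ) - Real.log (b.factorial : ℝ) -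
        Real.log (c.factorial : ℝ) - Real.log (d.factorial : ℝ) -
        ((a + b + c + d : ℕ) * Real.log (a + b + c + d : ℕ) - a * Real.log a - b * Real.log b -
          c * Real.log c - d * Real.log d)| ≤ 2 * Real.log (a + b + c + d : ℕ) + 5 := by
  have hn := abs_log_factorial_sub_le_one (a + b + c + d)
  have ha := abs_log_factorial_sub_le_one a
  have hb := abs_log_factorial_sub_le_one b
  have hc := abs_log_factorial_sub_le_one c
  have hd := abs_log_factorial_sub_le_one d
  -- each `log n_s ≤ log n`, and all are `≥ 0`
  have hl0 : ∀ m : ℕ, 0 ≤ Real.log m := fun m => by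
    rcases Nat.eq_zero_or_pos m with rfl | hm
    · simp
    · exact Real.log_nonneg (by exact_mod_cast hm)
  have hle : ∀ m : ℕ, m ≤ a + b + c + d → Real.log m ≤ Real.log (a + b + c + d : ℕ) := by
    intro m hm
    rcases Nat.eq_zero_or_pos m with rfl | hm0
    · simpa using hl0 (a + b + c + d)
    · exact Real.log_le_log (by exact_mod_cast hm0) (by exact_mod_cast hm)
  have h1 := hle a (by omega)
  have h2 := hle b (by omega)
  have h3 := hle c (by omega)
  have h4 := hle d (by omega)
  have h5 := hl0 a
  have h6 := hl0 b
  have h7 := hl0 c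
  have h8 := hl0 d
  have h9 := hl0 (a + b + c + d)
  rw [abs_le] at hn ha hb hc hd ⊢
  push_cast at hn h1 h2 h3 h4 h9 ⊢
  constructor <;> linarith [hn.1, hn.2, ha.1, ha.2, hb.1, hb.2, hc.1, hc.2, hd.1, hd.2]

/-! ## `x log x` bookkeeping -/

/-- Scaling: `n · xlogx (a/n) = a log a - a log n` for naturals `a` and `n ≥ 1`. -/
theorem natMul_xlogx_div (a : ℕ) {n : ℕ} (hn : n ≠ 0) :
    (n : ℝ) * xlogx ((a : ℝ) / n) = a * Real.log a - a * Real.log n := by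
  unfold xlogx
  have hn' : (n : ℝ) ≠ 0 := by exact_mod_cast hn
  rcases Nat.eq_zero_or_pos a with rfl | ha
  · simp
  have ha' : (a : ℝ) ≠ 0 := by exact_mod_cast ha.ne'
  rw [Real.log_div ha' hn']
  field_simp

/-- `xlogx (x/2) + (x/2) log 2 = (xlogx x)/2`. -/
theorem xlogx_half (x : ℝ) : xlogx (x / 2) + x / 2 * Real.log 2 = xlogx x / 2 := by
  unfold xlogx
  rcases eq_or_ne x 0 with rfl | hx
  · simp
  rw [Real.log_div hx two_ne_zero]
  ring

/-- **Half-class form of `coverPsi`**: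
`ψ = -(xlogx u + xlogx v + xlogx ν₁₁) - ½ xlogx (ν₁₀-u) - ½ xlogx (ν₀₁-v) - ½ xlogx (ν₀₀-u-v-ν₁₁)`. -/
theorem coverPsi_eq (ν₀₀ ν₁₀ ν₀₁ ν₁₁ u v : ℝ) :
    coverPsi ν₀₀ ν₁₀ ν₀₁ ν₁₁ u v =
      -(xlogx u + xlogx v + xlogx ν₁₁) - xlogx (ν₁₀ - u) / 2 - xlogx (ν₀₁ - v) / 2 -
        xlogx (ν₀₀ - u - v - ν₁₁) / 2 := by
  unfold coverPsi
  rw [xlogx_half, xlogx_half, xlogx_half]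

/-- The exponent of one `(u,v)`-summand at integer data, in `a log a` form: for naturals with
`u ≤ n₁₀`, `v ≤ n₀₁`, `u + v + n₁₁ ≤ n₀₀` and `n = Σ n_s ≥ 1`,
`n · (Σ_s xlogx (n_s/n) + coverPsi (n_s/n) (u/n) (v/n)) =
 [n₀₀ log n₀₀ + n₁₀ log n₁₀ + n₀₁ log n₀₁ - u log u - v log v - ½ a log a - ½ b log b - ½ r log r] - (n/2) log n`
with `a = n₁₀ - u`, `b = n₀₁ - v`, `r = n₀₀ - u - v - n₁₁`. -/
theorem natMul_exponent_eq {n00 n10 n01 n11 u v n : ℕ} (hu : u ≤ n10) (hv : v ≤ n01)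
    (hk : u + v + n11 ≤ n00) (hsum : n00 + n10 + n01 + n11 = n) (hn : n ≠ 0) :
    (n : ℝ) * (xlogx ((n00 : ℝ) / n) + xlogx ((n10 : ℝ) / n) + xlogx ((n01 : ℝ) / n) +
        xlogx ((n11 : ℝ) / n) +
        coverPsi ((n00 : ℝ) / n) ((n10 : ℝ) / n) ((n01 : ℝ) / n) ((n11 : ℝ) / n) ((u : ℝ) / n)
          ((v : ℝ) / n)) =
      (n00 * Real.log n00 + n10 * Real.log n10 + n01 * Real.log n01 - u * Real.log u -
          v * Real.log v - ((n10 - u : ℕ) : ℝ) * Real.log ((n10 - u : ℕ) : ℝ) / 2 -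
          ((n01 - v : ℕ) : ℝ) * Real.log ((n01 - v : ℕ) : ℝ) / 2 -
          ((n00 - (u + v + n11) : ℕ) : ℝ) * Real.log ((n00 - (u + v + n11) : ℕ) : ℝ) / 2) -
        (n : ℝ) / 2 * Real.log n := by
  rw [coverPsi_eq]
  have hn' : (n : ℝ) ≠ 0 := by exact_mod_cast hn
  -- the differences are naturals over `n`
  have e1 : (n10 : ℝ) / n - u / n = ((n10 - u : ℕ) : ℝ) / n := by
    rw [Nat.cast_sub hu]; ring
  have e2 : (n01 : ℝ) / n - v / n = ((n01 - v : ℕ) : ℝ) / n := by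
    rw [Nat.cast_sub hv]; ring
  have e3 : (n00 : ℝ) / n - u / n - v / n - n11 / n = ((n00 - (u + v + n11) : ℕ) : ℝ) / n := by
    rw [Nat.cast_sub hk]; push_cast; ring
  rw [e1, e2, e3]
  have H := fun a : ℕ => natMul_xlogx_div a hn
  have hlin : ((n00 : ℝ) + n10 + n01 + n11 - u - v - n11) -
      (((n10 - u : ℕ) : ℝ) + ((n01 - v : ℕ) : ℝ) + ((n00 - (u + v + n11) : ℕ) : ℝ)) / 2 = (n : ℝ) / 2 := by
    rw [Nat.cast_sub hu, Nat.cast_sub hv, Nat.cast_sub hk, ← hsum]; push_cast; ring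
  -- distribute `n` and use the scaling identity termwise
  have key : ∀ a : ℕ, (n : ℝ) * (xlogx ((a : ℝ) / n) / 2) = (a * Real.log a - a * Real.log n) / 2 := by
    intro a; rw [← H a]; ring
  calc (n : ℝ) * (xlogx ((n00 : ℝ) / n) + xlogx ((n10 : ℝ) / n) + xlogx ((n01 : ℝ) / n) +
        xlogx ((n11 : ℝ) / n) +
        (-(xlogx ((u : ℝ) / n) + xlogx ((v : ℝ) / n) + xlogx ((n11 : ℝ) / n)) -
          xlogx (((n10 - u : ℕ) : ℝ) / n) / 2 - xlogx (((n01 - v : ℕ) : ℝ) / n) / 2 -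
          xlogx (((n00 - (u + v + n11) : ℕ) : ℝ) / n) / 2))
      = (n : ℝ) * xlogx ((n00 : ℝ) / n) + (n : ℝ) * xlogx ((n10 : ℝ) / n) +
          (n : ℝ) * xlogx ((n01 : ℝ) / n) - (n : ℝ) * xlogx ((u : ℝ) / n) -
          (n : ℝ) * xlogx ((v : ℝ) / n) - (n : ℝ) * (xlogx (((n10 - u : ℕ) : ℝ) / n) / 2) -
          (n : ℝ) * (xlogx (((n01 - v : ℕ) : ℝ) / n) / 2) -
          (n : ℝ) * (xlogx (((n00 - (u + v + n11) : ℕ) : ℝ) / n) / 2) := by ring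
    _ = _ := by
      rw [H, H, H, H, H, key, key, key]
      have := hlin
      linear_combination (-(Real.log n)) * this

end Summit.PneNP.PneNP.Cruxes.PolyDepthTwinsAbove.AnnealedCoverTwins
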